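import Summits.RiemannHypothesis.RiemannHypothesis.Theorems.PfPersistenceProfileDerivPrime
import HarnessLib

/-!
# The residual hypothesis of the edge law made literal: differentiability of the increment
# function `t ↦ D_t(ũ)` at the prime-power lags (pub-rhpf, theory-1 gen 4; helper for crux
# `EvenSectorBarta.EvenOneSignedWindows`, item stmt-RiemannHypothesis-19953; RH-free)

**mechanism/rigidity campaign; no RH claims.**  Companion of `PfPersistenceEdgeLawUniversal`
(the universal edge law over the windowed-form interface) and of `PfPersistenceProfileDerivPrime`
(the profile is differentiable as soon as its prime-lag part is); text:
`run/shared/lean/pub/pub-rhpf/pub-rhpf-theory-1/THEORY-EDGE-4.md` §2.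

`hasDerivAt_weilPrimeLagPart_of_hasDerivAt_weilIncrement` (PROVED, sorry-free): the prime-lag part
`η ↦ Σ_{log n ≤ 2a} Λ(n) n^{-1/2} D_{log n}(ũ_η)` (`ũ = weilTrunc a u`, `ũ_η = weilDilate η ũ`,
`D_t = 2‖ũ‖² − 2 Re(ũ ⋆ ũ̃)(t)`) of the dilation profile is differentiable at `η = 0` as soon as the
increment function `t ↦ D_t(ũ)` is differentiable at the finitely many prime-power lags
`t = log n ∈ (0, 2a]` (`2 ≤ n`), with derivative `Σ Λ(n) n^{-1/2} · log n · D'_{log n}(ũ)` — the chain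
rule on the exact identity `D_{log n}(ũ_η) = D_{(1+η) log n}(ũ)` (`weilIncrement_weilDilate`).
With `PfPersistenceProfileDerivPrime` and `PfPersistenceEdgeLaw` this gives the EDGE LAW
`a · ε'(a) = −(V_sw(u) + Σ Λ(n) n^{-1/2} log n · D'_{log n}(ũ))` at every differentiability window of
`ε = weilGroundEnergy`, resp. at a.e. window with no hypothesis on `ε`, under EXACTLY the hypothesis
"the autocorrelation of the ground state is differentiable at the prime-power lags inside the
window" (`mul_deriv_weilGroundEnergy_eq_of_hasDerivAt_weilIncrement`,
`ae_mul_deriv_weilGroundEnergy_eq_of_hasDerivAt_weilIncrement`).  That hypothesis — interior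
regularity of Weil ground states — is OPEN in print and in the tree; THEORY-EDGE-4 §2 argues (DERIVED,
not proved) that `u ∈ W^{1,1}(−a, a)`, which suffices, while `u ∉ C¹` at the interior echo points
`±(a − log n)` of the edges, so the `C¹` hypothesis (h5) of THEORY-EDGE-3 was too strong as stated.

References: E. Bombieri, Rend. Mat. Acc. Lincei (9) 11 (2000) 183–233, §4 (proof of Thm 5: the
dilation); T. Kato, *Perturbation Theory for Linear Operators* (1966) VII §4.6.
-/

set_option linter.dupNamespace false

noncomputable section

open MeasureTheory Set Filter
open scoped Topology

namespace Summit.RiemannHypothesis.RiemannHypothesis.Theorems.PfPersistence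

open Literature.NumberTheory.LFunctions

/-! ## §3 The residual hypothesis made literal: differentiability of `t ↦ D_t(ũ)` at the prime lags -/

/-- **Chain rule for the prime-lag part.** If the increment function `t ↦ D_t(ũ)` of the truncated
state `ũ = weilTrunc a u` has derivative `d n` at every prime-power lag `log n ∈ (0, 2a]`
(`2 ≤ n`), then the prime-lag part of the dilation profile has derivative
`Σ Λ(n) n^{-1/2} · (log n · d n)` at `η = 0` (`D_{log n}(ũ_η) = D_{(1+η) log n}(ũ)`). [folklore] -/
theorem hasDerivAt_weilPrimeLagPart_of_hasDerivAt_weilIncrement {a : ℝ} {u : ℝ → ℂ} {d : ℕ → ℝ}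
    (hd : ∀ n ∈ (weilPrimeIndex (2 * a)).filter (fun n : ℕ ↦ 2 ≤ n ∧ Real.log (n : ℝ) ≤ 2 * a),
      HasDerivAt (weilIncrement (weilTrunc a u)) (d n) (Real.log n)) :
    HasDerivAt (weilPrimeLagPart a u)
      (∑ n ∈ (weilPrimeIndex (2 * a)).filter (fun n : ℕ ↦ 2 ≤ n ∧ Real.log (n : ℝ) ≤ 2 * a),
        (ArithmeticFunction.vonMangoldt n : ℝ) / Real.sqrt n * (Real.log n * d n)) 0 := by
  unfold weilPrimeLagPart
  refine HasDerivAt.fun_sum fun n hn ↦ ?_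
  refine HasDerivAt.const_mul _ ?_
  have hlin : HasDerivAt (fun η : ℝ ↦ (1 + η) * Real.log n) (Real.log n) 0 := by
    simpa using ((hasDerivAt_id (0 : ℝ)).const_add 1).mul_const (Real.log n)
  have hd' : HasDerivAt (weilIncrement (weilTrunc a u)) (d n) ((1 + (0 : ℝ)) * Real.log n) := by
    rw [add_zero, one_mul]
    exact hd n hn
  have hcomp : HasDerivAt (weilIncrement (weilTrunc a u) ∘ fun η : ℝ ↦ (1 + η) * Real.log n)
      (d n * Real.log n) 0 := hd'.comp 0 hlin
  refine (hcomp.congr_of_eventuallyEq ?_).congr_deriv (by ring)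
  filter_upwards [Ioi_mem_nhds (show (-1 : ℝ) < 0 by norm_num)] with η hη
  show weilIncrement (weilDilate η (weilTrunc a u)) (Real.log n) =
    weilIncrement (weilTrunc a u) ((1 + η) * Real.log n)
  exact weilIncrement_weilDilate _ hη _

/-- The dilation profile of a ground state is differentiable at `0` as soon as `t ↦ D_t(ũ)` is
differentiable at the prime-power lags inside the window; its derivative is the small-window
virial plus the prime-lag virial `Σ Λ(n) n^{-1/2} log n · D'_{log n}(ũ)`. [folklore] -/
theorem hasDerivAt_weilDilationProfile_of_hasDerivAt_weilIncrement {a : ℝ} {u : ℝ → ℂ}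
    (hu : IsWeilGroundState a u) {d : ℕ → ℝ}
    (hd : ∀ n ∈ (weilPrimeIndex (2 * a)).filter (fun n : ℕ ↦ 2 ≤ n ∧ Real.log (n : ℝ) ≤ 2 * a),
      HasDerivAt (weilIncrement (weilTrunc a u)) (d n) (Real.log n)) :
    HasDerivAt (weilDilationProfile a u)
      (weilSmallWindowVirial a u +
        ∑ n ∈ (weilPrimeIndex (2 * a)).filter (fun n : ℕ ↦ 2 ≤ n ∧ Real.log (n : ℝ) ≤ 2 * a),
          (ArithmeticFunction.vonMangoldt n : ℝ) / Real.sqrt n * (Real.log n * d n)) 0 :=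
  hasDerivAt_weilDilationProfile_of_primePart hu
    (hasDerivAt_weilPrimeLagPart_of_hasDerivAt_weilIncrement hd)

/-- **The edge law at every window, under interior regularity of the autocorrelation only**: at a
differentiability window `a`, for every ground state `u` whose increment function `t ↦ D_t(ũ)` is
differentiable at the prime-power lags `log n ∈ (0, 2a]`,
`a · ε'(a) = −(V_sw(u) + Σ Λ(n) n^{-1/2} log n · D'_{log n}(ũ))`. [folklore] -/
theorem mul_deriv_weilGroundEnergy_eq_of_hasDerivAt_weilIncrement {a : ℝ} {u : ℝ → ℂ}
    (hu : IsWeilGroundState a u) (hda : DifferentiableAt ℝ weilGroundEnergy a) {d : ℕ → ℝ}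
    (hd : ∀ n ∈ (weilPrimeIndex (2 * a)).filter (fun n : ℕ ↦ 2 ≤ n ∧ Real.log (n : ℝ) ≤ 2 * a),
      HasDerivAt (weilIncrement (weilTrunc a u)) (d n) (Real.log n)) :
    a * deriv weilGroundEnergy a =
      -(weilSmallWindowVirial a u +
        ∑ n ∈ (weilPrimeIndex (2 * a)).filter (fun n : ℕ ↦ 2 ≤ n ∧ Real.log (n : ℝ) ≤ 2 * a),
          (ArithmeticFunction.vonMangoldt n : ℝ) / Real.sqrt n * (Real.log n * d n)) :=
  mul_deriv_weilGroundEnergy_eq_neg hu hda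
    (hasDerivAt_weilDilationProfile_of_hasDerivAt_weilIncrement hu hd)

/-- The same at almost every window, with no hypothesis on `ε`. [folklore] -/
theorem ae_mul_deriv_weilGroundEnergy_eq_of_hasDerivAt_weilIncrement :
    ∀ᵐ a : ℝ, 0 < a → ∀ (u : ℝ → ℂ) (d : ℕ → ℝ), IsWeilGroundState a u →
      (∀ n ∈ (weilPrimeIndex (2 * a)).filter (fun n : ℕ ↦ 2 ≤ n ∧ Real.log (n : ℝ) ≤ 2 * a),
        HasDerivAt (weilIncrement (weilTrunc a u)) (d n) (Real.log n)) →
      a * deriv weilGroundEnergy a =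
        -(weilSmallWindowVirial a u +
          ∑ n ∈ (weilPrimeIndex (2 * a)).filter (fun n : ℕ ↦ 2 ≤ n ∧ Real.log (n : ℝ) ≤ 2 * a),
            (ArithmeticFunction.vonMangoldt n : ℝ) / Real.sqrt n * (Real.log n * d n)) := by
  filter_upwards [ae_mul_deriv_weilGroundEnergy_eq_neg] with a h ha u d hu hd
  exact h ha u _ hu (hasDerivAt_weilDilationProfile_of_hasDerivAt_weilIncrement hu hd)

end Summit.RiemannHypothesis.RiemannHypothesis.Theorems.PfPersistence

end
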